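import Literature.Computability.Cryptography.PeikertMachineFP
import Literature.Computability.Cryptography.PeikertScaling
import Literature.Computability.Complexity.TruthTableDecidersL
import Literature.Computability.Cryptography.SamplerCoinLaws
import Literature.Computability.Cryptography.StatisticalDistanceMixtures
import Literature.Probability.Distributions.IndepProductLawDistance
import Literature.Algebra.EuclideanLattices.BabaiResidualNorm
import HarnessLib

/-!
# The machine of Peikert's `GapSVP → BDD` reduction: what one iteration computes, block by block

Topic `Computability/Cryptography` (family `pqc`), first ANALYSIS file of `PeikertMachineSpec.lean` (the
queries/verdict of the first component of `peikert_gapSVPZeta_to_lwe_classical_of_components`, pqc.S20).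
Every quantity of iteration `j` is a function of coin block `j` alone (`wBlk`, `xBlk`, `uBlk`, `cBlk`,
`ansBlk`, `okBlk`; `wL_eq`, …, `okAt_eq`), and on a genuine instance these lists ARE the mathematical
objects of the analysis files (`PeikertPerturbation*.lean`, `PeikertReduction.lean`): with
`J = M·B` (`ScaledInstance.lean`) and `w` the sampled perturbation read as a vector,

* `sRows ι = matRows J.basis` (`sRows_eq_matRows_scale`), `J.vec = Babai.rowsR J.basis`;
* `xBlk = ofFn (Babai.intResidual J.basis w)` (`xBlk_eq_ofFn`) — the BDD target IS Babai's residual, so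
  `x - w ∈ L(J)` (`x_sub_w_mem_lattice`) and the view is lattice-invariant (`intResidual_add_of_mem`);
* `uBlk = code ((J, x), r)` (`uBlk_eq_encode`) — the query IS the code of the `GapCVP` instance
  `((M·B, x), r)` with `r = rRat` in lowest terms;
* `okBlk ↔ decodeIntVec n (answer) = x - w` (`okBlk_iff`);
* the verdict of a run: accept iff `d ≥ 1` and some `okBlk (block j)` fails, `j < N₀` (`verdict_run`).

All PROVED; no definition without body, no named fact.

## References

* C. Peikert, *Public-key cryptosystems from the worst-case shortest vector problem*, STOC 2009, proof
  of Thm. 3.1 [Peikert2009].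
-/

noncomputable section

namespace Literature.Computability.Cryptography

namespace Peikert2009

namespace Spec

open _root_.Computability Literature.Algebra.EuclideanLattices Literature.Algebra.EuclideanLattices.GapCodes
  Literature.Probability.Distributions Literature.Computability.Complexity Polynomial
  Literature.Computability.Complexity.LMat Literature.Computability.Cryptography.SIS.OddPartFP

variable (coinsR fuelR : Polynomial ℕ) (R : OracleAlg (List Bool)) (O : Oracle) (ι : Inp)

/-! ### Per-block quantities -/

/-- The perturbation read off a block. [cite: Peikert2009, Thm. 3.1 proof (step 1)] -/
def wBlk (blk : List Bool) : List ℤ :=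
  Literature.Computability.Cryptography.samplerVecOf (params ι).ctx (dim ι) (params ι).coinLen blk

/-- The BDD target read off a block. [cite: Peikert2009, Thm. 3.1 proof (step 2)] -/
def xBlk (blk : List Bool) : List ℤ := Babai.residualL (sRows ι) (wBlk ι blk) (dim ι)

/-- The query code read off a block. [cite: Peikert2009, Thm. 3.1 proof (step 3)] -/
def uBlk (blk : List Bool) : List Bool := cvpCode (dim ι) (sRows ι) (xBlk ι blk) (rNum ι) (rDen ι)

/-- The solver's coins read off a block. [cite: AroraBarak2009, Def. 7.1] -/
def cBlk (blk : List Bool) : List Bool :=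
  ((blk.drop ((params ι).coinLen * dim ι))).take (coinsR.eval (uBlk ι blk).length)

/-- The expected answer read off a block. [folklore] -/
def vBlk (blk : List Bool) : List ℤ := List.zipWith (· - ·) (xBlk ι blk) (wBlk ι blk)

/-- The solver's answer on a block (against the oracle `O`, `randAnswer`). [cite: AroraBarak2009, Def. 7.1] -/
def ansBlk (blk : List Bool) : List Bool := OracleAlg.randAnswer R fuelR [] O (boolPair (uBlk ι blk) (cBlk coinsR ι blk))

/-- Does the block's answer decode to `x - w`? [folklore] -/
def okBlk (blk : List Bool) : Bool := ansOK (dim ι) (vBlk ι blk) (ansBlk coinsR fuelR R O ι blk)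

/-- Iteration `j` reads block `j`. [folklore] -/
theorem wL_eq (r : List Bool) (j : ℕ) : wL ι coinsR r j = wBlk ι (block ι coinsR r j) := rfl
/-- Iteration `j` reads block `j`. [folklore] -/
theorem xL_eq (r : List Bool) (j : ℕ) : xL ι coinsR r j = xBlk ι (block ι coinsR r j) := rfl
/-- Iteration `j` reads block `j`. [folklore] -/
theorem uStr_eq (r : List Bool) (j : ℕ) : uStr ι coinsR r j = uBlk ι (block ι coinsR r j) := rfl
/-- Iteration `j` reads block `j`. [folklore] -/
theorem cStr_eq (r : List Bool) (j : ℕ) : cStr ι coinsR r j = cBlk coinsR ι (block ι coinsR r j) := rfl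
/-- Iteration `j` reads block `j`. [folklore] -/
theorem query_eq (r : List Bool) (j : ℕ) : query ι coinsR r j = boolPair (uBlk ι (block ι coinsR r j)) (cBlk coinsR ι (block ι coinsR r j)) := rfl
/-- Iteration `j` reads block `j`. [folklore] -/
theorem vL_eq (r : List Bool) (j : ℕ) : vL ι coinsR r j = vBlk ι (block ι coinsR r j) := rfl

/-- **The verdict of a run**: with the answers `aⱼ = randAnswer (query j)` of the subroutine, the machine
accepts iff `d ≥ 1` and some `okBlk (block j)`, `j < N₀`, fails. [cite: Peikert2009, Thm. 3.1 proof (step 4)] -/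
theorem verdict_run (r : List Bool) :
    verdict ι coinsR r ((List.range iters).map fun j => OracleAlg.randAnswer R fuelR [] O (query ι coinsR r j)) =
      (decide ((dden ι : ℤ) ≤ dnum ι) && (List.range iters).any fun j => !okBlk coinsR fuelR R O ι (block ι coinsR r j)) := by
  unfold verdict
  congr 1
  rw [Bool.eq_iff_iff, List.any_eq_true, List.any_eq_true]
  have key : ∀ j ∈ List.range iters,
      ((List.range iters).map fun j => OracleAlg.randAnswer R fuelR [] O (query ι coinsR r j)).getD j [] =
        ansBlk coinsR fuelR R O ι (block ι coinsR r j) := fun j hj => by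
    rw [List.getD_eq_getElem?_getD, List.getElem?_map, List.getElem?_range (List.mem_range.1 hj), Option.map_some,
      Option.getD_some]
    rfl
  constructor
  · rintro ⟨j, hj, h⟩
    exact ⟨j, hj, by rwa [key j hj] at h⟩
  · rintro ⟨j, hj, h⟩
    exact ⟨j, hj, by rwa [key j hj]⟩

/-! ### The scaled instance and the perturbation as a vector -/

/-- The scaled instance `J = M·B`. [cite: Peikert2009, §2 (full version p. 7)] -/
abbrev J : LatticeInstance := ι.1.1.scale (scale (dim ι))

/-- The scaled rows are the `ofFn` rows of `J`. [folklore] -/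
theorem sRows_eq_matRows_scale : sRows ι = matRows (J ι).basis := by
  simp only [sRows, matRows, List.map_ofFn]
  congr 1
  funext i
  rw [Function.comp_apply, List.map_ofFn]
  rfl

/-- The basis vectors of a lattice instance are its integer rows read in `ℝⁿ`. [folklore] -/
theorem vec_eq_rowsR (I : LatticeInstance) : I.vec = Babai.rowsR I.basis := rfl

/-- The perturbation as a vector: coordinate `i` is the flat sampler on chunk `i` of the block.
[cite: Peikert2009, Thm. 3.1 proof (step 1)] -/
def wVec (blk : List Bool) : Fin (dim ι) → ℤ := fun i => (params ι).samplerFlat (chunk (params ι).coinLen blk i)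

/-- The perturbation list is `ofFn wVec`. [folklore] -/
theorem wBlk_eq_ofFn (blk : List Bool) : wBlk ι blk = List.ofFn (wVec ι blk) := by
  rw [wBlk, samplerVecOf_ctx]
  refine List.ext_getElem (by simp) fun i h₁ h₂ => ?_
  simp [wVec]

/-- **The BDD target is Babai's residual**: `xBlk = ofFn (intResidual J.basis w)` (nonsingular `B`, `M ≥ 1`).
[cite: Babai1986, §3] -/
theorem xBlk_eq_ofFn (hI : ι.1.1.IsNonsingular) (blk : List Bool) :
    xBlk ι blk = List.ofFn (Babai.intResidual (J ι).basis (wVec ι blk)) := by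
  have hM : scale (dim ι) ≠ 0 := by unfold scale; positivity
  have hli : LinearIndependent ℝ (Babai.rowsR (J ι).basis) := by
    rw [← vec_eq_rowsR]; exact LatticeInstance.linearIndependent_vec (LatticeInstance.isNonsingular_scale hM hI)
  rw [xBlk, sRows_eq_matRows_scale, wBlk_eq_ofFn, matRows]
  exact Babai.residualL_ofFn _ _ hli

/-- The expected answer as a vector: `vBlk = ofFn (intResidual J.basis w - w)`. [folklore] -/
theorem vBlk_eq_ofFn (hI : ι.1.1.IsNonsingular) (blk : List Bool) :
    vBlk ι blk = List.ofFn (Babai.intResidual (J ι).basis (wVec ι blk) - wVec ι blk) := by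
  rw [vBlk, xBlk_eq_ofFn ι hI, wBlk_eq_ofFn]
  refine List.ext_getElem (by simp) fun i h₁ h₂ => ?_
  simp

/-- **`okBlk` says: the answer decodes to `x - w`.** [cite: Peikert2009, Thm. 3.1 proof (step 4)] -/
theorem okBlk_iff (hI : ι.1.1.IsNonsingular) (blk : List Bool) :
    okBlk coinsR fuelR R O ι blk = true ↔
      decodeIntVec (dim ι) (ansBlk coinsR fuelR R O ι blk) = Babai.intResidual (J ι).basis (wVec ι blk) - wVec ι blk := by
  rw [okBlk, vBlk_eq_ofFn ι hI, ansOK_ofFn_iff]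

/-- **The target is congruent to the perturbation modulo `L(J)`**: `x - w ∈ L(J)`. [cite: Babai1986, §3] -/
theorem x_sub_w_mem_lattice (hI : ι.1.1.IsNonsingular) (blk : List Bool) :
    intVecToEuclidean (dim ι) (Babai.intResidual (J ι).basis (wVec ι blk)) - intVecToEuclidean (dim ι) (wVec ι blk) ∈ (J ι).lattice := by
  have hM : scale (dim ι) ≠ 0 := by unfold scale; positivity
  have hli : LinearIndependent ℝ (Babai.rowsR (J ι).basis) := by
    rw [← vec_eq_rowsR]; exact LatticeInstance.linearIndependent_vec (LatticeInstance.isNonsingular_scale hM hI)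
  rw [Babai.intVecToEuclidean_intResidual _ hli]
  have h := Babai.residual_sub_mem_span (dim ι) (Babai.rowsR (J ι).basis) (intVecToEuclidean (dim ι) (wVec ι blk))
  rw [← vec_eq_rowsR] at h
  exact h

/-- **The view is lattice-invariant**: `intResidual (z + w) = intResidual w` for `z ∈ L(J)`. [cite: Babai1986, §3] -/
theorem intResidual_add_of_mem (hI : ι.1.1.IsNonsingular) (z w : Fin (dim ι) → ℤ)
    (hz : intVecToEuclidean (dim ι) z ∈ (J ι).lattice) :
    Babai.intResidual (J ι).basis (z + w) = Babai.intResidual (J ι).basis w := by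
  have hM : scale (dim ι) ≠ 0 := by unfold scale; positivity
  have hli : LinearIndependent ℝ (Babai.rowsR (J ι).basis) := by
    rw [← vec_eq_rowsR]; exact LatticeInstance.linearIndependent_vec (LatticeInstance.isNonsingular_scale hM hI)
  apply intVecToEuclidean_injective (dim ι)
  rw [Babai.intVecToEuclidean_intResidual _ hli, Babai.intVecToEuclidean_intResidual _ hli, map_add]
  refine Babai.residual_add_of_mem_span' (dim ι) (Babai.rowsR (J ι).basis) hli ?_ _
  rw [← vec_eq_rowsR]; exact hz

/-! ### The query is the code of the `GapCVP` instance `((J, x), r)` -/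

/-- The `GapCVP` instance queried on a block. [cite: Peikert2009, Thm. 3.1 proof (step 3)] -/
def cvpInst (blk : List Bool) : GapCVPInstance :=
  (⟨J ι, Babai.intResidual (J ι).basis (wVec ι blk)⟩, rRat ι)

/-- **`uBlk` is the code of `cvpInst`.** [cite: MicciancioGoldwasser2002, Ch. 1 §1.2] -/
theorem uBlk_eq_encode (hI : ι.1.1.IsNonsingular) (blk : List Bool) :
    uBlk ι blk = GapCVPInstance.encode (cvpInst ι blk) := by
  obtain ⟨hnum, hden⟩ := rRat_num_den ι
  rw [uBlk, xBlk_eq_ofFn ι hI, sRows_eq_matRows_scale, ← hnum, ← hden, cvpCode_eq_encode, toMat_matRows]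
  rfl

end Spec

end Peikert2009

end Literature.Computability.Cryptography

end


/-!
# The machine of Peikert's `GapSVP → BDD` reduction: the laws of what it reads off its coins

Topic `Computability/Cryptography` (family `pqc`), second analysis file of `PeikertMachineSpec.lean`
(after `PeikertMachineBlocks.lean`). The machine reads ONE uniform coin string; this file turns the
acceptance event into the product form the estimates of `PeikertPerturbation*.lean` are stated in:

* coins → blocks (`CoinBlockLaws.uniformVector_map_chunks_eq_indepLaw`): the `N₀` blocks are
  independent uniform words, so an event "for every / some iteration" has probability a power / at most
  a multiple of the one-block probability (`prob_coins_forall_mem`, `prob_coins_exists_mem_le`);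
* block → (sampler part, tail) (`splitAB`, uniform pair): the perturbation is `samplerVec` of the sampler
  part (`wVec_append`), the solver's coins are a prefix of the tail, so `okBlk` is a function `okW w T`
  of the perturbation VECTOR `w` and the tail `T` (`okBlk_append`);
* hence **`prob_block_okBlk_eq`**: the one-block probability of `okBlk = b` is that of `okW = b` under
  `(⨂ⁿ ℓ') ⊗ U(tail)` — the law `ν = indepLaw n lawPMF` of the sampled vector
  (`uniformVector_map_samplerVec_eq_indepLaw`), within `n·8·2^{-m}` of the rounded Gaussian
  (`tvDist_nu_roundedGaussian_le`), paired with independent uniform tail coins.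

Small PMF lemmas: `toOuterMeasure_indepLaw_eval`, `toOuterMeasure_compl_add`, `bind_map_prod_comm`.
All PROVED; no named fact.

## References

* C. Peikert, *Public-key cryptosystems from the worst-case shortest vector problem*, STOC 2009, proof
  of Thm. 3.1 [Peikert2009].
* S. Arora, B. Barak, *Computational Complexity: A Modern Approach*, CUP 2009, Def. 7.1, §7.4.1
  (independent repetitions of a probabilistic machine) [AroraBarak2009].
-/

noncomputable section

namespace Literature.Computability.Cryptography

namespace Peikert2009

namespace Spec

open _root_.Computability Literature.Algebra.EuclideanLattices Literature.Algebra.EuclideanLattices.GapCodes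
  Literature.Probability.Distributions Literature.Computability.Complexity Polynomial PMF
  Literature.Computability.Cryptography.SIS.OddPartFP
open scoped ENNReal

/-! ### PMF lemmas -/

/-- The marginal of an independent product: `Pr[v j ∈ A] = p j (A)`. [folklore] -/
theorem toOuterMeasure_indepLaw_eval {α : Type*} (K : ℕ) (p : Fin K → PMF α) (j : Fin K) (A : Set α) :
    (indepLaw K p).toOuterMeasure {v | v j ∈ A} = (p j).toOuterMeasure A := by
  classical
  have hset : {v : Fin K → α | v j ∈ A} = {v | ∀ i, v i ∈ (if i = j then A else Set.univ)} := by
    ext v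
    simp only [Set.mem_setOf_eq]
    constructor
    · intro h i; split_ifs with hi
      · subst hi; exact h
      · exact Set.mem_univ _
    · intro h; simpa using h j
  rw [hset, toOuterMeasure_indepLaw_pi]
  rw [Finset.prod_eq_single j (fun i _ hi => by rw [if_neg hi, toOuterMeasure_apply_eq_one_iff]; exact fun _ _ => Set.mem_univ _)
    (fun h => (h (Finset.mem_univ j)).elim), if_pos rfl]

/-- `Pr[S] + Pr[Sᶜ] = 1` for a `PMF`. [folklore] -/
theorem toOuterMeasure_compl_add {α : Type*} (p : PMF α) (S : Set α) :
    p.toOuterMeasure S + p.toOuterMeasure Sᶜ = 1 := by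
  classical
  rw [toOuterMeasure_apply, toOuterMeasure_apply, ← ENNReal.tsum_add, ← p.tsum_coe]
  congr 1
  funext x
  by_cases hx : x ∈ S
  · rw [Set.indicator_of_mem hx, Set.indicator_of_notMem (Set.notMem_compl_iff.2 hx), add_zero]
  · rw [Set.indicator_of_notMem hx, Set.indicator_of_mem (Set.mem_compl hx), zero_add]

/-- `Pr[Sᶜ]` in `ℝ`: `1 - Pr[S]`. [folklore] -/
theorem toReal_toOuterMeasure_compl {α : Type*} (p : PMF α) (S : Set α) :
    (p.toOuterMeasure Sᶜ).toReal = 1 - (p.toOuterMeasure S).toReal := by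
  have h := toOuterMeasure_compl_add p S
  have h1 : p.toOuterMeasure S ≠ ∞ := ne_top_of_le_ne_top ENNReal.one_ne_top (h ▸ le_self_add)
  have h2 : p.toOuterMeasure Sᶜ ≠ ∞ := ne_top_of_le_ne_top ENNReal.one_ne_top (h ▸ le_add_self)
  have := congrArg ENNReal.toReal h
  rw [ENNReal.toReal_add h1 h2, ENNReal.toReal_one] at this
  linarith

/-- Pairing two independent laws in either order gives the same joint law (up to swapping).
[folklore] -/
theorem bind_map_prod_comm {α β : Type*} (μ : PMF α) (ν : PMF β) :
    (μ.bind fun a => ν.map fun b => (a, b)) = ν.bind fun b => μ.map fun a => (a, b) := by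
  simp only [PMF.map]
  exact PMF.bind_comm μ ν _

/-! ### Coins → blocks -/

variable (coinsR fuelR : Polynomial ℕ) (R : OracleAlg (List Bool)) (O : Oracle) (ι : Inp)

/-- Block `j < N₀` of a coin string of length `≥ L N₀` is chunk `j`. [folklore] -/
theorem block_toList_eq_chunks {C : ℕ} (hC : blockLen ι coinsR * iters ≤ C) (r : List.Vector Bool C) (j : Fin iters) :
    block ι coinsR r.toList j = (chunks (blockLen ι coinsR) iters hC r j).toList := rfl

/-- **"For every iteration"**: the probability that every block lands in `S` is `Pr_block[S]^{N₀}`.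
[cite: AroraBarak2009, §7.4.1] -/
theorem prob_coins_forall_mem {C : ℕ} (hC : blockLen ι coinsR * iters ≤ C) (S : Set (List Bool)) :
    (uniformOfFintype (List.Vector Bool C)).toOuterMeasure {r | ∀ j < iters, block ι coinsR r.toList j ∈ S} =
      ((uniformOfFintype (List.Vector Bool (blockLen ι coinsR))).toOuterMeasure {b | b.toList ∈ S}) ^ iters := by
  classical
  have hpre : {r : List.Vector Bool C | ∀ j < iters, block ι coinsR r.toList j ∈ S} =
      chunks (blockLen ι coinsR) iters hC ⁻¹' {v | ∀ j, (v j).toList ∈ S} := by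
    ext r
    simp only [Set.mem_setOf_eq, Set.mem_preimage]
    constructor
    · intro h j; rw [← block_toList_eq_chunks]; exact h j j.isLt
    · intro h j hj; have := h ⟨j, hj⟩; rwa [← block_toList_eq_chunks] at this
  rw [hpre, ← toOuterMeasure_map_apply, uniformVector_map_chunks_eq_indepLaw,
    show {v : Fin iters → List.Vector Bool (blockLen ι coinsR) | ∀ j, (v j).toList ∈ S} =
      {v | ∀ j, v j ∈ ({b | b.toList ∈ S} : Set (List.Vector Bool (blockLen ι coinsR)))} from rfl,
    toOuterMeasure_indepLaw_pi iters (fun _ => uniformOfFintype (List.Vector Bool (blockLen ι coinsR))) fun _ => {b | b.toList ∈ S},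
    Finset.prod_const, Finset.card_univ, Fintype.card_fin]

/-- **"For some iteration"** (union bound): the probability that some block lands in `S` is at most
`N₀ · Pr_block[S]`. [cite: AroraBarak2009, §7.4.1] -/
theorem prob_coins_exists_mem_le {C : ℕ} (hC : blockLen ι coinsR * iters ≤ C) (S : Set (List Bool)) :
    (uniformOfFintype (List.Vector Bool C)).toOuterMeasure {r | ∃ j < iters, block ι coinsR r.toList j ∈ S} ≤
      iters * (uniformOfFintype (List.Vector Bool (blockLen ι coinsR))).toOuterMeasure {b | b.toList ∈ S} := by
  classical
  have hpre : {r : List.Vector Bool C | ∃ j < iters, block ι coinsR r.toList j ∈ S} =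
      chunks (blockLen ι coinsR) iters hC ⁻¹' ⋃ j : Fin iters, {v | (v j).toList ∈ S} := by
    ext r
    simp only [Set.mem_setOf_eq, Set.mem_preimage, Set.mem_iUnion]
    constructor
    · rintro ⟨j, hj, h⟩; exact ⟨⟨j, hj⟩, by rwa [← block_toList_eq_chunks]⟩
    · rintro ⟨j, h⟩; exact ⟨j, j.isLt, by rwa [← block_toList_eq_chunks] at h⟩
  rw [hpre, ← toOuterMeasure_map_apply, uniformVector_map_chunks_eq_indepLaw]
  refine (MeasureTheory.measure_iUnion_fintype_le _ _).trans ?_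
  have hj : ∀ j : Fin iters, (indepLaw iters fun _ => uniformOfFintype (List.Vector Bool (blockLen ι coinsR))).toOuterMeasure
      {v | (v j).toList ∈ S} = (uniformOfFintype (List.Vector Bool (blockLen ι coinsR))).toOuterMeasure {b | b.toList ∈ S} := fun j =>
    toOuterMeasure_indepLaw_eval iters (fun _ => uniformOfFintype (List.Vector Bool (blockLen ι coinsR))) j {b | b.toList ∈ S}
  simp only [hj, Finset.sum_const, Finset.card_univ, Fintype.card_fin, nsmul_eq_mul]
  rfl

/-! ### Block → (sampler part, tail) -/

/-- Splitting a word of length `a + b` into its prefix and suffix. [folklore] -/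
def splitAB (a b : ℕ) : List.Vector Bool (a + b) ≃ List.Vector Bool a × List.Vector Bool b where
  toFun r := (⟨r.toList.take a, by simp⟩, ⟨r.toList.drop a, by simp⟩)
  invFun p := ⟨p.1.toList ++ p.2.toList, by simp⟩
  left_inv r := List.Vector.eq _ _ (by simp)
  right_inv p := by
    obtain ⟨v, w⟩ := p
    refine Prod.ext (List.Vector.eq _ _ ?_) (List.Vector.eq _ _ ?_)
    · simp
    · simp

/-- **A uniform word split into prefix and suffix is a pair of independent uniform words.** [cite: AroraBarak2009, Def. 7.1] -/
theorem uniform_map_splitAB (a b : ℕ) :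
    (uniformOfFintype (List.Vector Bool (a + b))).map (splitAB a b) =
      (uniformOfFintype (List.Vector Bool a)).bind fun s => (uniformOfFintype (List.Vector Bool b)).map fun t => (s, t) := by
  rw [PMF.uniformOfFintype_map_equiv (splitAB a b), uniformOfFintype_prod_eq_bind]

/-- A chunk of index `< n` of `s ++ t` with `|s| = K n` is the chunk of `s`. [folklore] -/
theorem chunk_append_of_lt (K n : ℕ) {i : ℕ} (s t : List Bool) (hs : s.length = K * n) (hi : i < n) :
    chunk K (s ++ t) i = chunk K s i := by
  simp only [chunk]
  rw [List.drop_append_of_le_length (by rw [hs]; exact Nat.mul_le_mul_left K hi.le), List.take_append_of_le_length]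
  rw [List.length_drop, hs]
  have : K * i + K ≤ K * n := by rw [← Nat.mul_succ]; exact Nat.mul_le_mul_left K hi
  omega

/-- **The perturbation only reads the sampler part**: on `s ++ t` (`|s| = coinLen · n`) it is `samplerVec` of `s`.
[cite: Peikert2009, Thm. 3.1 proof (step 1)] -/
theorem wVec_append (s : List.Vector Bool ((params ι).coinLen * dim ι)) (t : List Bool) :
    wVec ι (s.toList ++ t) = PGParams.samplerVec (params ι) (dim ι) le_rfl s := by
  funext i
  simp only [wVec, PGParams.samplerVec, toList_chunks]
  rw [chunk_append_of_lt _ _ _ _ s.toList_length i.isLt]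

/-- The tail of `s ++ t` (`|s| = coinLen · n`) is `t`. [folklore] -/
theorem drop_samplerPart (s : List.Vector Bool ((params ι).coinLen * dim ι)) (t : List Bool) :
    (s.toList ++ t).drop ((params ι).coinLen * dim ι) = t := by
  rw [List.drop_append_of_le_length (by simp), List.drop_of_length_le (by simp), List.nil_append]

/-- The `GapCVP` instance of a perturbation vector. [cite: Peikert2009, Thm. 3.1 proof (step 3)] -/
def cvpOf (w : Fin (dim ι) → ℤ) : GapCVPInstance := (⟨J ι, Babai.intResidual (J ι).basis w⟩, rRat ι)

/-- **`okBlk` as a function of the perturbation vector and the tail**: does the answer of the solver,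
run on the code of `cvpOf w` with the first `coinsR |code|` tail bits as coins, decode to
`residual(w) - w`? [cite: Peikert2009, Thm. 3.1 proof (step 4)] -/
def okW (w : Fin (dim ι) → ℤ) (t : List Bool) : Bool :=
  decide (decodeIntVec (dim ι) (OracleAlg.randAnswer R fuelR [] O
      (boolPair (GapCVPInstance.encode (cvpOf ι w)) (t.take (coinsR.eval (GapCVPInstance.encode (cvpOf ι w)).length)))) =
    Babai.intResidual (J ι).basis w - w)

/-- **On a genuine instance `okBlk (s ++ t) = okW (samplerVec s) t`.** [cite: Peikert2009, Thm. 3.1 proof] -/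
theorem okBlk_append (hI : ι.1.1.IsNonsingular) (s : List.Vector Bool ((params ι).coinLen * dim ι)) (t : List Bool) :
    okBlk coinsR fuelR R O ι (s.toList ++ t) = okW coinsR fuelR R O ι (PGParams.samplerVec (params ι) (dim ι) le_rfl s) t := by
  have hw := wVec_append ι s t
  rw [okW, ← hw]
  by_cases h : decodeIntVec (dim ι) (ansBlk coinsR fuelR R O ι (s.toList ++ t)) =
      Babai.intResidual (J ι).basis (wVec ι (s.toList ++ t)) - wVec ι (s.toList ++ t)
  · rw [(okBlk_iff coinsR fuelR R O ι hI _).2 h]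
    symm; rw [decide_eq_true_eq]
    convert h using 2
    rw [ansBlk, uBlk_eq_encode ι hI, cBlk, uBlk_eq_encode ι hI, drop_samplerPart]
    rfl
  · have h1 : okBlk coinsR fuelR R O ι (s.toList ++ t) = false := by
      rw [← Bool.not_eq_true]; exact fun h' => h ((okBlk_iff coinsR fuelR R O ι hI _).1 h')
    rw [h1]; symm; rw [decide_eq_false_iff_not]
    convert h using 2
    rw [ansBlk, uBlk_eq_encode ι hI, cBlk, uBlk_eq_encode ι hI, drop_samplerPart]
    rfl

/-! ### The one-block probability in product form -/

/-- The law of the sampled perturbation vector: `ν = ⨂ⁿ ℓ'`. [folklore] -/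
abbrev nu : PMF (Fin (dim ι) → ℤ) := indepLaw (dim ι) fun _ => (params ι).lawPMF

/-- The joint law of (tail coins, perturbation): independent, `U(tail) ⊗ μ`, in the pairing order of
`prob_names_perturbation_roundedGaussian_le_unit`. [folklore] -/
def jointLaw (μ : PMF (Fin (dim ι) → ℤ)) : PMF (List.Vector Bool (tailLen ι coinsR) × (Fin (dim ι) → ℤ)) :=
  (uniformOfFintype (List.Vector Bool (tailLen ι coinsR))).bind fun t => μ.map fun w => (t, w)

/-- The event `okW = b` on (tail, perturbation) pairs. [folklore] -/
def okEvent (b : Bool) : Set (List.Vector Bool (tailLen ι coinsR) × (Fin (dim ι) → ℤ)) :=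
  {p | okW coinsR fuelR R O ι p.2 p.1.toList = b}

/-- **The one-block probability of `okBlk = b` is `Pr_{U(tail) ⊗ ν}[okW = b]`.**
[cite: Peikert2009, Thm. 3.1 proof; AroraBarak2009, Def. 7.1] -/
theorem prob_block_okBlk_eq (hI : ι.1.1.IsNonsingular) (b : Bool) :
    (uniformOfFintype (List.Vector Bool (blockLen ι coinsR))).toOuterMeasure {blk | okBlk coinsR fuelR R O ι blk.toList = b} =
      (jointLaw coinsR ι (nu ι)).toOuterMeasure (okEvent coinsR fuelR R O ι b) := by
  classical
  change (uniformOfFintype (List.Vector Bool ((params ι).coinLen * dim ι + tailLen ι coinsR))).toOuterMeasure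
      {blk | okBlk coinsR fuelR R O ι blk.toList = b} = _
  -- through the split `blk = s ++ t`
  have hsplit : {blk : List.Vector Bool ((params ι).coinLen * dim ι + tailLen ι coinsR) | okBlk coinsR fuelR R O ι blk.toList = b} =
      splitAB ((params ι).coinLen * dim ι) (tailLen ι coinsR) ⁻¹'
        {p | okW coinsR fuelR R O ι (PGParams.samplerVec (params ι) (dim ι) le_rfl p.1) p.2.toList = b} := by
    ext blk
    simp only [Set.mem_setOf_eq, Set.mem_preimage]
    have hblk : blk.toList = (splitAB ((params ι).coinLen * dim ι) (tailLen ι coinsR) blk).1.toList ++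
        (splitAB ((params ι).coinLen * dim ι) (tailLen ι coinsR) blk).2.toList :=
      (List.take_append_drop ((params ι).coinLen * dim ι) blk.toList).symm
    rw [show okBlk coinsR fuelR R O ι blk.toList = okBlk coinsR fuelR R O ι
        ((splitAB ((params ι).coinLen * dim ι) (tailLen ι coinsR) blk).1.toList ++
          (splitAB ((params ι).coinLen * dim ι) (tailLen ι coinsR) blk).2.toList) by rw [← hblk],
      okBlk_append coinsR fuelR R O ι hI]
  rw [hsplit, ← toOuterMeasure_map_apply, uniform_map_splitAB]
  -- push the sampler part through `samplerVec`
  have hev : {p : List.Vector Bool ((params ι).coinLen * dim ι) × List.Vector Bool (tailLen ι coinsR) |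
      okW coinsR fuelR R O ι (PGParams.samplerVec (params ι) (dim ι) le_rfl p.1) p.2.toList = b} =
      (fun p => (p.2, PGParams.samplerVec (params ι) (dim ι) le_rfl p.1)) ⁻¹' okEvent coinsR fuelR R O ι b := rfl
  rw [hev, ← toOuterMeasure_map_apply, PMF.map_bind]
  simp only [PMF.map_comp, Function.comp_def]
  have hnu : nu ι = (uniformOfFintype (List.Vector Bool ((params ι).coinLen * dim ι))).map (PGParams.samplerVec (params ι) (dim ι) le_rfl) :=
    (PGParams.uniformVector_map_samplerVec_eq_indepLaw (params ι) (dim ι) le_rfl).symm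
  rw [jointLaw, bind_map_prod_comm, hnu, PMF.bind_map]
  rfl

/-! ### The law `ν` is close to the rounded Gaussian -/

/-- `Y ≥ 2^{2m + 2r + 3}` when `d ≥ 1`. [folklore] -/
theorem yOf_ge (hd : (dden ι : ℤ) ≤ dnum ι) : 2 ^ (2 * prec (dim ι) + 2 * PGParams.rOf (prec (dim ι)) + 3) ≤ yOf ι := by
  have hden : 0 < dden ι := ι.1.2.den_pos
  have hnum : dden ι ≤ (dnum ι).natAbs := by
    have := hd; omega
  unfold yOf scale
  rw [Nat.le_div_iff_mul_le (by positivity)]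
  have hsq : dden ι ^ 2 ≤ (dnum ι).natAbs ^ 2 := Nat.pow_le_pow_left hnum 2
  calc 2 ^ (2 * prec (dim ι) + 2 * PGParams.rOf (prec (dim ι)) + 3) * (32 * dden ι ^ 2)
      = 2 ^ (2 * (prec (dim ι) + PGParams.rOf (prec (dim ι)) + 4)) * dden ι ^ 2 := by ring
    _ ≤ (2 ^ (prec (dim ι) + PGParams.rOf (prec (dim ι)) + 4)) ^ 2 * (dnum ι).natAbs ^ 2 := by
        rw [← pow_mul, mul_comm (prec (dim ι) + _ + 4) 2]; exact Nat.mul_le_mul_left _ hsq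

/-- **The mesh is fine enough for the sampler**: `m + rOf m + 1 ≤ b` when `d ≥ 1`. [folklore] -/
theorem prec_add_rOf_succ_le_mesh (hd : (dden ι : ℤ) ≤ dnum ι) :
    prec (dim ι) + PGParams.rOf (prec (dim ι)) + 1 ≤ mesh ι := by
  have hY := yOf_ge ι hd
  have hsize : 2 * prec (dim ι) + 2 * PGParams.rOf (prec (dim ι)) + 3 < Nat.size (yOf ι) := Nat.lt_size.2 hY
  unfold mesh; omega

/-- `1 ≤ m`. [folklore] -/
theorem one_le_prec (n : ℕ) : 1 ≤ prec n := by unfold prec; omega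

/-- **The sampled vector is within `n · 8 · 2^{-m}` of the rounded Gaussian of width `σ₀ = 2ᵇ/√2`.**
[folklore] -/
theorem tvDist_nu_roundedGaussian_le (hd : (dden ι : ℤ) ≤ dnum ι) :
    (nu ι).tvDist (roundedGaussian (dim ι) ((2 : ℝ) ^ mesh ι / Real.sqrt 2)) ≤ dim ι * (8 * ((2 : ℝ) ^ prec (dim ι))⁻¹) := by
  have h := tvDist_indepLaw_lawPMF_roundedGaussian_le (dim ι) (params ι) (PGParams.one_le_k_std _ _) (PGParams.pNone_pow_J_std_lt_one _ _)
  refine h.trans (mul_le_mul_of_nonneg_left ?_ (Nat.cast_nonneg _))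
  exact PGParams.errorBound_std_le _ _ (one_le_prec _) (prec_add_rOf_succ_le_mesh ι hd)

end Spec

end Peikert2009

end Literature.Computability.Cryptography

end


/-!
# The machine of Peikert's `GapSVP → BDD` reduction: one iteration on a YES instance is fooled with constant probability

Topic `Computability/Cryptography` (family `pqc`), third analysis file of `PeikertMachineSpec.lean`.
On a YES instance `(B, d)` (`λ₁(L(B)) ≤ d`, so `L(M·B)` has a nonzero vector of norm `≤ Md`), whatever
the solver does, ONE iteration's answer decodes to `x - w` with probability at most
`1 - hidingAdvantage + n·8·2^{-m}`: the width the machine picks, `σ₀ = 2ᵇ/√2`, satisfies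
`Md ≤ 16 σ₀` (`scaledD_le_sixteen_sigma0`, from `Y < 4^{b+1}`), so the ball-overlap hiding bound
`Peikert2009.prob_names_perturbation_roundedGaussian_le_unit` applies to the exact rounded Gaussian
with the lattice-invariant view `w ↦ residual(w)` (`intResidual_add_of_mem`), and the actual law of `w`
is within `n·8·2^{-m}` of it (`tvDist_nu_roundedGaussian_le`).

* `sigma0`, `sigma0_pos`, `half_le_sigma0`, `sigma0_le_scaledD_div_eight`, `scaledD_le_sixteen_sigma0`;
* **`prob_block_ok_le_of_yes`** — `Pr_block[okBlk] ≤ 1 - hidingAdvantage + n·8·2^{-m}`.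

All PROVED; no named fact.

## References

* C. Peikert, *Public-key cryptosystems from the worst-case shortest vector problem*, STOC 2009, proof
  of Thm. 3.1 (YES case) [Peikert2009].
* O. Goldreich, S. Goldwasser, *On the limits of nonapproximability of lattice problems*, JCSS 60
  (2000), §3 [GoldreichGoldwasser2000].
-/

noncomputable section

namespace Literature.Computability.Cryptography

namespace Peikert2009

namespace Spec

open _root_.Computability Literature.Algebra.EuclideanLattices Literature.Algebra.EuclideanLattices.GapCodes
  Literature.Probability.Distributions Literature.Computability.Complexity Polynomial PMF
  Literature.Computability.Cryptography.SIS.OddPartFP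
open scoped ENNReal

variable (coinsR fuelR : Polynomial ℕ) (R : OracleAlg (List Bool)) (O : Oracle) (ι : Inp)

/-! ### The width `σ₀ = 2ᵇ/√2` and its window `(Md/16, Md/8]` -/

/-- The width of the rounded Gaussian the sampler imitates: `σ₀ = 2ᵇ/√2`. [folklore] -/
def sigma0 : ℝ := (2 : ℝ) ^ mesh ι / Real.sqrt 2

/-- The scaled distance `D = M d`. [folklore] -/
def scaledD : ℝ := scale (dim ι) * (ι.1.2 : ℝ)

/-- `σ₀ > 0`. [folklore] -/
theorem sigma0_pos : 0 < sigma0 ι := by unfold sigma0; positivity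

/-- `1/2 ≤ σ₀` (indeed `σ₀ ≥ 1/√2`). [folklore] -/
theorem half_le_sigma0 : 1 / 2 ≤ sigma0 ι := by
  unfold sigma0
  rw [div_le_div_iff₀ (by norm_num) (by positivity), one_mul]
  have h1 : (1 : ℝ) ≤ 2 ^ mesh ι := one_le_pow₀ (by norm_num)
  have h2 : Real.sqrt 2 ≤ 2 := by
    rw [Real.sqrt_le_left (by norm_num)]; norm_num
  linarith

/-- The threshold as a real: `d = num d / den d`, `den d > 0`. [folklore] -/
theorem d_eq_num_div_den : (ι.1.2 : ℝ) = (dnum ι : ℝ) / (dden ι : ℝ) := Rat.cast_def _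

/-- `d > 0` when `den d ≤ num d`. [folklore] -/
theorem d_pos (hd : (dden ι : ℤ) ≤ dnum ι) : 0 < (ι.1.2 : ℝ) := by
  have hden : (0 : ℝ) < dden ι := by exact_mod_cast ι.1.2.den_pos
  have hnum : (0 : ℝ) < dnum ι := by
    have : (0 : ℤ) < dnum ι := lt_of_lt_of_le (by exact_mod_cast ι.1.2.den_pos) hd
    exact_mod_cast this
  rw [d_eq_num_div_den]; positivity

/-- `D = M d ≥ 0` when `den d ≤ num d`. [folklore] -/
theorem scaledD_nonneg (hd : (dden ι : ℤ) ≤ dnum ι) : 0 ≤ scaledD ι := by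
  unfold scaledD; have := d_pos ι hd; positivity

/-- `Y ≤ (M d)²/32` (as reals). [folklore] -/
theorem yOf_le (hd : (dden ι : ℤ) ≤ dnum ι) : (yOf ι : ℝ) ≤ scaledD ι ^ 2 / 32 := by
  have hden : (0 : ℝ) < dden ι := by exact_mod_cast ι.1.2.den_pos
  have hnum0 : (0 : ℝ) ≤ dnum ι := by
    have : (0 : ℤ) ≤ dnum ι := le_trans (by positivity) hd
    exact_mod_cast this
  have habs : ((dnum ι).natAbs : ℝ) = dnum ι := by
    rw [Nat.cast_natAbs, Int.cast_abs, abs_of_nonneg hnum0]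
  have hfloor : (yOf ι : ℝ) ≤ (scale (dim ι) : ℝ) ^ 2 * ((dnum ι).natAbs : ℝ) ^ 2 / (32 * (dden ι : ℝ) ^ 2) := by
    unfold yOf
    have h := Nat.cast_div_le (α := ℝ) (m := scale (dim ι) ^ 2 * (dnum ι).natAbs ^ 2) (n := 32 * dden ι ^ 2)
    push_cast at h ⊢
    exact h
  refine hfloor.trans (le_of_eq ?_)
  rw [scaledD, d_eq_num_div_den, habs]
  field_simp

/-- `(M d)²/32 < Y + 1` (as reals). [folklore] -/
theorem lt_yOf_add_one : scaledD ι ^ 2 / 32 < (yOf ι : ℝ) + 1 := by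
  have hden : (0 : ℝ) < dden ι := by exact_mod_cast ι.1.2.den_pos
  have habs : ((dnum ι).natAbs : ℝ) ^ 2 = (dnum ι : ℝ) ^ 2 := by
    rw [Nat.cast_natAbs, Int.cast_abs, sq_abs]
  have h := Nat.lt_div_mul_add (a := scale (dim ι) ^ 2 * (dnum ι).natAbs ^ 2) (b := 32 * dden ι ^ 2) (by positivity)
  have h' : ((scale (dim ι) ^ 2 * (dnum ι).natAbs ^ 2 : ℕ) : ℝ) < ((yOf ι + 1) * (32 * dden ι ^ 2) : ℕ) := by
    unfold yOf; exact_mod_cast (by rw [add_mul, one_mul]; exact h)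
  push_cast at h'
  rw [habs] at h'
  rw [scaledD, d_eq_num_div_den, div_lt_iff₀ (by norm_num : (0 : ℝ) < 32)]
  rw [mul_pow, div_pow]
  rw [show (scale (dim ι) : ℝ) ^ 2 * ((dnum ι : ℝ) ^ 2 / (dden ι : ℝ) ^ 2) =
      (scale (dim ι) : ℝ) ^ 2 * (dnum ι : ℝ) ^ 2 / (dden ι : ℝ) ^ 2 by ring, div_lt_iff₀ (by positivity)]
  linarith

/-- `2b ≤ size Y - 1` and `size Y ≤ 2b + 2`. [folklore] -/
theorem two_mesh_bounds : 2 * mesh ι ≤ Nat.size (yOf ι) - 1 ∧ Nat.size (yOf ι) ≤ 2 * mesh ι + 2 := by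
  unfold mesh; omega

/-- **`σ₀ ≤ M d / 8`** (from `4ᵇ ≤ Y ≤ (Md)²/32`; needs `d ≥ 1`). [folklore] -/
theorem sigma0_le_scaledD_div_eight (hd : (dden ι : ℤ) ≤ dnum ι) : sigma0 ι ≤ scaledD ι / 8 := by
  have hY1 : 1 ≤ yOf ι := le_trans (Nat.one_le_two_pow) (yOf_ge ι hd)
  have hsize : 0 < Nat.size (yOf ι) := Nat.size_pos.2 hY1
  have h4b : 4 ^ mesh ι ≤ yOf ι := by
    have h1 : 2 ^ (Nat.size (yOf ι) - 1) ≤ yOf ι := Nat.lt_size.1 (by omega)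
    have h2 : 2 ^ (2 * mesh ι) ≤ 2 ^ (Nat.size (yOf ι) - 1) := Nat.pow_le_pow_right two_pos (two_mesh_bounds ι).1
    rw [pow_mul] at h2
    exact h2.trans h1
  have h4bR : ((2 : ℝ) ^ mesh ι) ^ 2 ≤ scaledD ι ^ 2 / 32 := by
    have : ((4 ^ mesh ι : ℕ) : ℝ) ≤ yOf ι := by exact_mod_cast h4b
    push_cast at this
    rw [show ((2 : ℝ) ^ mesh ι) ^ 2 = 4 ^ mesh ι by rw [← pow_mul, mul_comm, pow_mul]; norm_num]
    exact this.trans (yOf_le ι hd)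
  have hD : 0 ≤ scaledD ι := scaledD_nonneg ι hd
  have hpos : (0 : ℝ) ≤ 2 ^ mesh ι := by positivity
  -- `2^b ≤ D/√32 = D/(4√2)`, so `2^b/√2 ≤ D/8`
  unfold sigma0
  rw [div_le_div_iff₀ (by positivity) (by norm_num)]
  have hsq : ((2 : ℝ) ^ mesh ι * 8) ^ 2 ≤ (scaledD ι * Real.sqrt 2) ^ 2 := by
    rw [mul_pow, mul_pow, Real.sq_sqrt (by norm_num)]
    nlinarith
  exact (pow_le_pow_iff_left₀ (by positivity) (by positivity) two_ne_zero).1 hsq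

/-- **`M d ≤ 16 σ₀`** (from `(Md)²/32 < Y + 1 ≤ 4^{b+1}`). [folklore] -/
theorem scaledD_le_sixteen_sigma0 (hd : (dden ι : ℤ) ≤ dnum ι) : scaledD ι ≤ 16 * sigma0 ι := by
  have hY : yOf ι + 1 ≤ 4 ^ (mesh ι + 1) := by
    have h1 : yOf ι < 2 ^ Nat.size (yOf ι) := Nat.lt_size_self _
    have h2 : 2 ^ Nat.size (yOf ι) ≤ 2 ^ (2 * mesh ι + 2) := Nat.pow_le_pow_right two_pos (two_mesh_bounds ι).2
    rw [show 2 * mesh ι + 2 = 2 * (mesh ι + 1) by ring, pow_mul] at h2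
    norm_num at h2
    omega
  have hYR : (yOf ι : ℝ) + 1 ≤ 4 * ((2 : ℝ) ^ mesh ι) ^ 2 := by
    have : ((yOf ι + 1 : ℕ) : ℝ) ≤ ((4 ^ (mesh ι + 1) : ℕ) : ℝ) := by exact_mod_cast hY
    push_cast at this
    rw [show ((2 : ℝ) ^ mesh ι) ^ 2 = 4 ^ mesh ι by rw [← pow_mul, mul_comm, pow_mul]; norm_num]
    rw [pow_succ] at this
    linarith
  have hlt := lt_yOf_add_one ι
  have hD : 0 ≤ scaledD ι := scaledD_nonneg ι hd
  -- `D² < 32 · 4 · 4^b = (16 σ₀)²`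
  have hsq : scaledD ι ^ 2 ≤ (16 * sigma0 ι) ^ 2 := by
    unfold sigma0
    rw [mul_pow, div_pow, Real.sq_sqrt (by norm_num)]
    nlinarith
  exact (pow_le_pow_iff_left₀ hD (by have := sigma0_pos ι; positivity) two_ne_zero).1 hsq

/-! ### The YES bound for one block -/

/-- **On a YES instance one iteration is fooled with probability at least `hidingAdvantage - n·8·2^{-m}`**:
`Pr_block[okBlk] ≤ 1 - hidingAdvantage + n · 8 · 2^{-m}`. [cite: Peikert2009, Thm. 3.1 proof (YES case)] -/
theorem prob_block_ok_le_of_yes {ζ γ : ℕ → ℝ} (hyes : ι.1 ∈ GapSVPZeta.yes ζ γ) (hn : 1 ≤ dim ι) :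
    ((uniformOfFintype (List.Vector Bool (blockLen ι coinsR))).toOuterMeasure
        {blk | okBlk coinsR fuelR R O ι blk.toList = true}).toReal ≤
      1 - hidingAdvantage + dim ι * (8 * ((2 : ℝ) ^ prec (dim ι))⁻¹) := by
  have hI : ι.1.1.IsNonsingular := hyes.1.1
  have hd1 : (1 : ℝ) ≤ ι.1.2 := hyes.1.2.2.2.1
  have hd : (dden ι : ℤ) ≤ dnum ι := by
    have h := hd1
    rw [d_eq_num_div_den ι, le_div_iff₀ (by exact_mod_cast ι.1.2.den_pos), one_mul] at h
    exact_mod_cast h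
  rw [prob_block_okBlk_eq coinsR fuelR R O ι hI true]
  -- compare with the exact rounded Gaussian
  set rG := roundedGaussian (dim ι) (sigma0 ι) with hrG
  have htv : |((jointLaw coinsR ι (nu ι)).toOuterMeasure (okEvent coinsR fuelR R O ι true)).toReal -
      ((jointLaw coinsR ι rG).toOuterMeasure (okEvent coinsR fuelR R O ι true)).toReal| ≤ dim ι * (8 * ((2 : ℝ) ^ prec (dim ι))⁻¹) := by
    refine (abs_toReal_toOuterMeasure_sub_le_tvDist _ _ _).trans ?_
    rw [jointLaw, jointLaw, bind_map_prod_comm, bind_map_prod_comm (uniformOfFintype _) rG]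
    exact (tvDist_bind_left_le _ _ _).trans (tvDist_nu_roundedGaussian_le ι hd)
  -- the hiding bound for the exact rounded Gaussian
  have hM1 : 1 ≤ scale (dim ι) := Nat.one_le_two_pow
  have hz := exists_short_vector_scale hyes hM1 hn
  have hhide : ((jointLaw coinsR ι rG).toOuterMeasure (okEvent coinsR fuelR R O ι true)).toReal ≤ 1 - hidingAdvantage := by
    have h := prob_names_perturbation_roundedGaussian_le_unit (J := J ι) (uniformOfFintype (List.Vector Bool (tailLen ι coinsR)))
      (red := Babai.intResidual (J ι).basis) (lift := id)
      (run := fun x t => OracleAlg.randAnswer R fuelR [] O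
        (boolPair (GapCVPInstance.encode ((⟨J ι, x⟩ : CVPInstance), rRat ι))
          (t.toList.take (coinsR.eval (GapCVPInstance.encode ((⟨J ι, x⟩ : CVPInstance), rRat ι)).length))))
      (dec := decodeIntVec (dim ι))
      (fun z w hz => intResidual_add_of_mem ι hI z w hz) (sigma0_pos ι)
      (D := scaledD ι) (scaledD_nonneg ι hd) (scaledD_le_sixteen_sigma0 ι hd)
      (by simpa [scaledD] using hz)
    have hset : okEvent coinsR fuelR R O ι true =
        {p : List.Vector Bool (tailLen ι coinsR) × (Fin (dim ι) → ℤ) |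
          decodeIntVec (dim ι) (OracleAlg.randAnswer R fuelR [] O
            (boolPair (GapCVPInstance.encode ((⟨J ι, Babai.intResidual (J ι).basis p.2⟩ : CVPInstance), rRat ι))
              (p.1.toList.take (coinsR.eval (GapCVPInstance.encode
                ((⟨J ι, Babai.intResidual (J ι).basis p.2⟩ : CVPInstance), rRat ι)).length)))) =
            id (Babai.intResidual (J ι).basis p.2) - p.2} := by
      ext p; simp [okEvent, okW, cvpOf]
    rw [hset]
    exact h
  have := abs_sub_le_iff.1 htv
  linarith [this.1]

end Spec

end Peikert2009

end Literature.Computability.Cryptography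

end


/-!
# The machine of Peikert's `GapSVP → BDD` reduction: one iteration on a NO instance rarely misfires

Topic `Computability/Cryptography` (family `pqc`), fourth analysis file of `PeikertMachineSpec.lean`.
On a NO instance of `GapSVP_{ζ,γ}` with `γ ≥ γ₀ = 2n/α` the answer of a solver that succeeds on
admissible `BDD` inputs with probability `≥ 1 - ε` decodes to `x - w` except with probability at most
`2^{n/2}e^{-2n} + n·8·2^{-m} + ε`: unless the perturbation is exceptionally long
(`roundedGaussian_norm_tail_le` at width `σ₀ ≤ Md/8`, plus the sampler's statistical error), the queried
instance `((M·B, x), r)` is `f`-admissible with the unique admissible answer `x - w`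
(`Peikert2009.no_case_scaled_unit`, the machine's dyadic `r ∈ [A, 4A/3] ⊆ [r₀, 2r₀]`, `A_le_rRat`,
`rRat_le`), the query is short (`length_uBlk_le_uBound`, so its coins are a prefix of the tail — a
uniform string, `uniform_map_takeV`) and the solver's guarantee applies (`SolvesBDD` at dimension `n`).

* `uniform_map_takeV`; `length_cvpCode_mono`, `abs_intResidual_le_entryBound`, `length_encode_cvpOf_le_uBound`;
* `numA_pos`, `denA_pos`, `A_le_rRat`, `rRat_lt`, `rRat_le_four_thirds`;
* **`prob_block_notok_le_of_no`** — `Pr_block[okBlk = false] ≤ 2^{n/2}e^{-2n} + n·8·2^{-m} + ε`.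

All PROVED; no named fact.

## References

* C. Peikert, *Public-key cryptosystems from the worst-case shortest vector problem*, STOC 2009, proof
  of Thm. 3.1 (NO case) and Prop. 3.2 [Peikert2009].
-/

noncomputable section

namespace Literature.Computability.Cryptography

namespace Peikert2009

namespace Spec

open _root_.Computability Literature.Algebra.EuclideanLattices Literature.Algebra.EuclideanLattices.GapCodes
  Literature.Probability.Distributions Literature.Computability.Complexity Polynomial PMF Filter
  Literature.Computability.Complexity.LMat Literature.Computability.Cryptography.SIS.OddPartFP
  Literature.Computability.Complexity.CodeFP
open scoped ENNReal

/-! ### A prefix of a uniform word is uniform -/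

/-- The first `ℓ` bits of a word of length `L ≥ ℓ`. [folklore] -/
def takeV {L : ℕ} (ℓ : ℕ) (h : ℓ ≤ L) (t : List.Vector Bool L) : List.Vector Bool ℓ := ⟨t.toList.take ℓ, by simp [h]⟩

/-- **A prefix of a uniform word is uniform.** [cite: AroraBarak2009, Def. 7.1] -/
theorem uniform_map_takeV {L : ℕ} (ℓ : ℕ) (h : ℓ ≤ L) :
    (uniformOfFintype (List.Vector Bool L)).map (takeV ℓ h) = uniformOfFintype (List.Vector Bool ℓ) := by
  obtain ⟨D, rfl⟩ := Nat.exists_eq_add_of_le h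
  have htake : takeV ℓ h = Prod.fst ∘ splitAB ℓ D := rfl
  rw [htake, ← PMF.map_comp, uniform_map_splitAB, PMF.map_bind]
  have hc : ∀ a : List.Vector Bool ℓ, ((uniformOfFintype (List.Vector Bool D)).map fun t => (a, t)).map Prod.fst = PMF.pure a :=
    fun a => by rw [PMF.map_comp]; exact PMF.map_const _ _
  simp only [hc, PMF.bind_pure]

/-! ### The query is short: `|code ((J, x), r)| ≤ uBound` -/

/-- The length of `listE smE` is monotone in the magnitudes of the entries. [folklore] -/
theorem length_listE_smE_mono {l l' : List ℤ} (hlen : l.length = l'.length)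
    (h : ∀ i, (l.getD i 0).natAbs ≤ (l'.getD i 0).natAbs) : (listE smE l).length ≤ (listE smE l').length := by
  induction l generalizing l' with
  | nil => cases l' with
    | nil => exact le_rfl
    | cons _ _ => simp at hlen
  | cons a l ih =>
    cases l' with
    | nil => simp at hlen
    | cons b l' =>
      simp only [List.length_cons, Nat.succ_inj] at hlen
      have h0 := h 0
      simp only [List.getD_cons_zero] at h0
      have ht : ∀ i, (l.getD i 0).natAbs ≤ (l'.getD i 0).natAbs := fun i => by simpa using h (i + 1)
      have ih' := ih hlen ht
      simp only [listE, length_boolPair, List.length_cons, hlen, rawE_cons] at ih' ⊢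
      have hab : (smE a).length ≤ (smE b).length := by
        show (encodingIntBool.encode a).length ≤ (encodingIntBool.encode b).length
        rw [length_encode_int, length_encode_int]
        have := Nat.size_le_size h0
        rw [← length_natE, ← length_natE] at this
        exact Nat.add_le_add_right this 4
      omega

/-- The length of `cvpCode` is monotone in the magnitudes of the target's entries. [folklore] -/
theorem length_cvpCode_mono (n : ℕ) (rows : List (List ℤ)) (xs xs' : List ℤ) (num : ℤ) (den : ℕ)
    (h : ∀ i, (xs.getD i 0).natAbs ≤ (xs'.getD i 0).natAbs) :
    (cvpCode n rows xs num den).length ≤ (cvpCode n rows xs' num den).length := by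
  unfold cvpCode
  simp only [length_boolPair]
  have := length_listE_smE_mono (l := (List.range n).map fun i => xs.getD i 0) (l' := (List.range n).map fun i => xs'.getD i 0)
    (by simp) (fun i => by
      by_cases hi : i < n
      · rw [getD_map_range _ hi, getD_map_range _ hi]; exact h i
      · rw [getD_map_range_of_le _ (not_lt.1 hi), getD_map_range_of_le _ (not_lt.1 hi)])
  omega

variable (coinsR fuelR : Polynomial ℕ) (R : OracleAlg (List Bool)) (O : Oracle) (ι : Inp)

/-- Coordinates are bounded by the Euclidean norm. [folklore] -/
theorem abs_apply_le_norm {k : ℕ} (v : EuclideanSpace ℝ (Fin k)) (j : Fin k) : |v j| ≤ ‖v‖ := by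
  rw [← Real.norm_eq_abs]
  exact PiLp.norm_apply_le v j

/-- A vector with coordinates bounded by `C` has norm `≤ √k · C`. [folklore] -/
theorem norm_le_sqrt_mul {k : ℕ} (v : EuclideanSpace ℝ (Fin k)) {C : ℝ} (hC : 0 ≤ C) (h : ∀ j, |v j| ≤ C) :
    ‖v‖ ≤ Real.sqrt k * C := by
  rw [EuclideanSpace.norm_eq]
  have hsum : ∑ j, ‖v j‖ ^ 2 ≤ k * C ^ 2 := by
    calc ∑ j, ‖v j‖ ^ 2 ≤ ∑ _j : Fin k, C ^ 2 := Finset.sum_le_sum fun j _ => by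
            rw [Real.norm_eq_abs]; exact pow_le_pow_left₀ (abs_nonneg _) (h j) 2
      _ = k * C ^ 2 := by simp
  calc Real.sqrt (∑ j, ‖v j‖ ^ 2) ≤ Real.sqrt (k * C ^ 2) := Real.sqrt_le_sqrt hsum
    _ = Real.sqrt k * C := by rw [Real.sqrt_mul (Nat.cast_nonneg _), Real.sqrt_sq hC]

/-- The sum `S = ∑|Bᵢⱼ|` bounds every entry. [folklore] -/
theorem natAbs_basis_le_sum (i j : Fin (dim ι)) :
    (ι.1.1.basis i j).natAbs ≤ ((rowMajor (dim ι) (matRows ι.1.1.basis)).map Int.natAbs).sum := by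
  have hm : (i : ℕ) * dim ι + j < dim ι * dim ι := by
    have := i.isLt; have := j.isLt; nlinarith
  have hget : (rowMajor (dim ι) (matRows ι.1.1.basis)).getD (i * dim ι + j) 0 = ι.1.1.basis i j := by
    rw [rowMajor, getD_map_range _ hm]
    have hdiv : ((i : ℕ) * dim ι + j) / dim ι = i := by
      rw [Nat.add_comm, Nat.add_mul_div_right _ _ (by have := j.isLt; omega), Nat.div_eq_of_lt j.isLt, Nat.zero_add]
    have hmod : ((i : ℕ) * dim ι + j) % dim ι = j := by
      rw [Nat.add_comm, Nat.add_mul_mod_self_right, Nat.mod_eq_of_lt j.isLt]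
    rw [hdiv, hmod]; exact ent_matRows _ i j
  have hlt : (i : ℕ) * dim ι + j < (rowMajor (dim ι) (matRows ι.1.1.basis)).length := by rw [length_rowMajor]; exact hm
  have hmem : (ι.1.1.basis i j).natAbs ∈ (rowMajor (dim ι) (matRows ι.1.1.basis)).map Int.natAbs := by
    rw [← hget, List.getD_eq_getElem?_getD, List.getElem?_eq_getElem hlt]
    exact List.mem_map.2 ⟨_, List.getElem_mem hlt, rfl⟩
  exact List.single_le_sum (fun _ _ => Nat.zero_le _) _ hmem

/-- **The BDD target has small entries**: `|xᵢ| ≤ n · M · ∑|Bᵢⱼ| = entryBound - 1`. [folklore] -/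
theorem natAbs_intResidual_le (hI : ι.1.1.IsNonsingular) (w : Fin (dim ι) → ℤ) (i : Fin (dim ι)) :
    (Babai.intResidual (J ι).basis w i).natAbs ≤ entryBound ι - 1 := by
  set S : ℕ := ((rowMajor (dim ι) (matRows ι.1.1.basis)).map Int.natAbs).sum with hS
  -- the scaling as an opaque real (its unfolding is astronomically large)
  obtain ⟨Mr, hMr⟩ : ∃ Mr : ℝ, ((scale (dim ι) : ℕ) : ℝ) = Mr := ⟨_, rfl⟩
  have hMr0 : 0 ≤ Mr := hMr ▸ Nat.cast_nonneg _
  have hM : scale (dim ι) ≠ 0 := by unfold scale; positivity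
  have hli : LinearIndependent ℝ (Babai.rowsR (J ι).basis) := by
    rw [← vec_eq_rowsR]; exact LatticeInstance.linearIndependent_vec (LatticeInstance.isNonsingular_scale hM hI)
  have hn0 : (0 : ℝ) ≤ dim ι := Nat.cast_nonneg _
  have hS0 : (0 : ℝ) ≤ S := Nat.cast_nonneg _
  -- `|xᵢ| ≤ ‖x‖ = ‖residual‖ ≤ √(∑‖J.vec i‖²)/2 ≤ n M S`
  have hrow : ∀ k : Fin (dim ι), ‖Babai.rowsR (J ι).basis k‖ ≤ Real.sqrt (dim ι) * (Mr * S) := fun k => by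
    refine norm_le_sqrt_mul _ (mul_nonneg hMr0 hS0) fun j => ?_
    have hv : (Babai.rowsR (J ι).basis k) j = ((scale (dim ι) : ℤ) * ι.1.1.basis k j : ℤ) := by
      rw [← vec_eq_rowsR, LatticeInstance.vec_apply]
    have hB : |(ι.1.1.basis k j : ℝ)| ≤ (S : ℝ) := by
      have h0 := natAbs_basis_le_sum ι k j
      rw [← hS] at h0
      have h0R : ((ι.1.1.basis k j).natAbs : ℝ) ≤ S := by exact_mod_cast h0
      rwa [Nat.cast_natAbs, Int.cast_abs] at h0R
    rw [hv]; push_cast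
    rw [hMr, abs_mul, abs_of_nonneg hMr0]
    exact mul_le_mul_of_nonneg_left hB hMr0
  have hres : ‖Babai.residual (dim ι) (Babai.rowsR (J ι).basis) (intVecToEuclidean (dim ι) w)‖ ≤ (dim ι : ℝ) * (Mr * S) := by
    refine (Babai.norm_residual_le (k := dim ι) (f := Babai.rowsR (J ι).basis) (by simp) hli _).trans ?_
    have hsum : ∑ k, ‖Babai.rowsR (J ι).basis k‖ ^ 2 ≤ (dim ι : ℝ) * (Real.sqrt (dim ι) * (Mr * S)) ^ 2 := by
      calc ∑ k, ‖Babai.rowsR (J ι).basis k‖ ^ 2 ≤ ∑ _k : Fin (dim ι), (Real.sqrt (dim ι) * (Mr * S)) ^ 2 :=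
            Finset.sum_le_sum fun k _ => pow_le_pow_left₀ (norm_nonneg _) (hrow k) 2
        _ = _ := by simp
    have hprod : 0 ≤ (dim ι : ℝ) * (Mr * S) := mul_nonneg hn0 (mul_nonneg hMr0 hS0)
    have hsq : Real.sqrt (∑ k, ‖Babai.rowsR (J ι).basis k‖ ^ 2) ≤ (dim ι : ℝ) * (Mr * S) := by
      refine (Real.sqrt_le_sqrt hsum).trans (le_of_eq ?_)
      rw [mul_pow, Real.sq_sqrt hn0, ← mul_assoc, show (dim ι : ℝ) * dim ι * (Mr * S) ^ 2 =
        ((dim ι : ℝ) * (Mr * S)) ^ 2 by ring, Real.sqrt_sq hprod]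
    linarith
  have hxi : |(Babai.intResidual (J ι).basis w i : ℝ)| ≤ (dim ι : ℝ) * (Mr * S) := by
    have h1 : |(Babai.intResidual (J ι).basis w i : ℝ)| ≤ ‖intVecToEuclidean (dim ι) (Babai.intResidual (J ι).basis w)‖ :=
      abs_apply_le_norm (intVecToEuclidean (dim ι) (Babai.intResidual (J ι).basis w)) i
    have h2 : intVecToEuclidean (dim ι) (Babai.intResidual (J ι).basis w) =
        Babai.residual (dim ι) (Babai.rowsR (J ι).basis) (intVecToEuclidean (dim ι) w) := Babai.intVecToEuclidean_intResidual _ hli w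
    rw [h2] at h1
    exact h1.trans hres
  have hE : entryBound ι - 1 = dim ι * scale (dim ι) * S := by rw [entryBound, Nat.add_sub_cancel, hS]
  rw [hE]
  have h' : ((Babai.intResidual (J ι).basis w i).natAbs : ℝ) ≤ ((dim ι * scale (dim ι) * S : ℕ) : ℝ) := by
    rw [Nat.cast_natAbs, Int.cast_abs]; push_cast; rw [hMr, mul_assoc]; exact hxi
  exact_mod_cast h'

/-- **The query is short**: `|code ((J, x), r)| ≤ uBound`. [folklore] -/
theorem length_encode_cvpOf_le_uBound (hI : ι.1.1.IsNonsingular) (w : Fin (dim ι) → ℤ) :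
    (GapCVPInstance.encode (cvpOf ι w)).length ≤ uBound ι := by
  obtain ⟨hnum, hden⟩ := rRat_num_den ι
  have hcode : GapCVPInstance.encode (cvpOf ι w) = cvpCode (dim ι) (sRows ι) (List.ofFn (Babai.intResidual (J ι).basis w)) (rNum ι) (rDen ι) := by
    rw [cvpOf, sRows_eq_matRows_scale, ← hnum, ← hden, cvpCode_eq_encode, toMat_matRows]
  rw [hcode, uBound]
  refine length_cvpCode_mono _ _ _ _ _ _ fun i => ?_
  by_cases hi : i < dim ι
  · have h1 : (List.ofFn (Babai.intResidual (J ι).basis w)).getD i 0 = Babai.intResidual (J ι).basis w ⟨i, hi⟩ := by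
      simp [List.getD_eq_getElem?_getD, hi]
    have h2 : (List.replicate (dim ι) (entryBound ι : ℤ)).getD i 0 = entryBound ι := by
      simp [List.getD_eq_getElem?_getD, hi]
    rw [h1, h2, Int.natAbs_natCast]
    exact (natAbs_intResidual_le ι hI w ⟨i, hi⟩).trans (Nat.sub_le _ _)
  · rw [List.getD_eq_default _ _ (by simpa using not_lt.1 hi)]
    exact Nat.zero_le _

/-! ### The radius `r` lies in `[A, 4A/3]` -/

/-- `denA > 0` on a genuine instance (`n, aden ≥ 1`, `num d ≠ 0`). [folklore] -/
theorem denA_pos (hn : 1 ≤ dim ι) (ha : 1 ≤ aden ι) (hd : (dden ι : ℤ) ≤ dnum ι) : 0 < denA ι := by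
  have hnum : 0 < (dnum ι).natAbs := by
    have : (0 : ℤ) < dnum ι := lt_of_lt_of_le (by exact_mod_cast ι.1.2.den_pos) hd
    omega
  unfold denA scale; positivity

/-- `numA > 0` when `q ≥ 1` and `num a ≠ 0`. [folklore] -/
theorem numA_pos (hq : 1 ≤ qv ι) (ha : anum ι ≠ 0) : 0 < numA ι := by
  have : 0 < (anum ι).natAbs := Int.natAbs_pos.2 ha
  have : 0 < dden ι := ι.1.2.den_pos
  unfold numA; positivity

/-- **`A ≤ r`**: `(2t + 1) denA ≥ numA 2^{K+1}`. [folklore] -/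
theorem A_le_rRat (hden : 0 < denA ι) : (numA ι : ℝ) / denA ι ≤ rRat ι := by
  have hkey : numA ι * 2 ^ (kExp ι + 1) ≤ (2 * tNum ι + 1) * denA ι := by
    unfold tNum
    have h := Nat.div_add_mod (numA ι * 2 ^ (kExp ι + 1) + denA ι - 1) (2 * denA ι)
    have hmod := Nat.mod_lt (numA ι * 2 ^ (kExp ι + 1) + denA ι - 1) (show 0 < 2 * denA ι by omega)
    set Q := (numA ι * 2 ^ (kExp ι + 1) + denA ι - 1) / (2 * denA ι)
    set P := numA ι * 2 ^ (kExp ι + 1)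
    have e1 : 2 * denA ι * Q = 2 * (denA ι * Q) := by ring
    have e2 : (2 * Q + 1) * denA ι = 2 * (denA ι * Q) + denA ι := by ring
    rw [e1] at h
    rw [e2]
    omega
  have hkeyR : (numA ι : ℝ) * 2 ^ (kExp ι + 1) ≤ (2 * tNum ι + 1) * denA ι := by exact_mod_cast hkey
  unfold rRat rNum rDen
  push_cast
  rw [div_le_div_iff₀ (by exact_mod_cast hden) (by positivity)]
  linarith

/-- **`r < A + 2^{-K}`**. [folklore] -/
theorem rRat_lt (hden : 0 < denA ι) : (rRat ι : ℝ) < (numA ι : ℝ) / denA ι + ((2 : ℝ) ^ kExp ι)⁻¹ := by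
  have hkey : (2 * tNum ι + 1) * denA ι < numA ι * 2 ^ (kExp ι + 1) + 2 * denA ι := by
    unfold tNum
    have h := Nat.div_mul_le_self (numA ι * 2 ^ (kExp ι + 1) + denA ι - 1) (2 * denA ι)
    set Q := (numA ι * 2 ^ (kExp ι + 1) + denA ι - 1) / (2 * denA ι)
    set P := numA ι * 2 ^ (kExp ι + 1)
    have e1 : Q * (2 * denA ι) = 2 * (denA ι * Q) := by ring
    have e2 : (2 * Q + 1) * denA ι = 2 * (denA ι * Q) + denA ι := by ring
    rw [e1] at h
    rw [e2]
    omega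
  have hkeyR : ((2 * tNum ι + 1) * denA ι : ℝ) < numA ι * 2 ^ (kExp ι + 1) + 2 * denA ι := by exact_mod_cast hkey
  unfold rRat rNum rDen
  push_cast
  have hdenR : (0 : ℝ) < denA ι := by exact_mod_cast hden
  have h1 : (2 * (tNum ι : ℝ) + 1) < (numA ι : ℝ) / denA ι * 2 ^ (kExp ι + 1) + 2 := by
    rw [div_mul_eq_mul_div]
    calc (2 * (tNum ι : ℝ) + 1) = (2 * (tNum ι : ℝ) + 1) * denA ι / denA ι := (mul_div_cancel_right₀ _ hdenR.ne').symm
      _ < (numA ι * 2 ^ (kExp ι + 1) + 2 * denA ι) / denA ι := div_lt_div_of_pos_right hkeyR hdenR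
      _ = numA ι * 2 ^ (kExp ι + 1) / denA ι + 2 := by rw [add_div, mul_div_cancel_right₀ _ hdenR.ne']
  have e2 : ((2 : ℝ) ^ kExp ι)⁻¹ * 2 ^ (kExp ι + 1) = 2 := by
    rw [pow_succ, ← mul_assoc, inv_mul_cancel₀ (by positivity), one_mul]
  rw [div_lt_iff₀ (by positivity), add_mul, e2]
  exact h1

/-- `2^{-K} < 1/(3 denA) ≤ A/3` (`numA ≥ 1`), whence **`r ≤ 4A/3`**. [folklore] -/
theorem rRat_le_four_thirds (hden : 0 < denA ι) (hnum : 0 < numA ι) : (rRat ι : ℝ) ≤ 4 / 3 * ((numA ι : ℝ) / denA ι) := by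
  have h1 := rRat_lt ι hden
  have hK : 3 * denA ι < 2 ^ kExp ι := by unfold kExp; exact Nat.lt_size_self _
  have hKR : (3 * denA ι : ℝ) < 2 ^ kExp ι := by exact_mod_cast hK
  have hdenR : (0 : ℝ) < denA ι := by exact_mod_cast hden
  have hnumR : (1 : ℝ) ≤ numA ι := by exact_mod_cast hnum
  have h2 : ((2 : ℝ) ^ kExp ι)⁻¹ ≤ (numA ι : ℝ) / denA ι / 3 := by
    rw [inv_le_iff_one_le_mul₀ (by positivity), div_div, div_mul_eq_mul_div, one_le_div (by positivity)]
    nlinarith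
  linarith


/-! ### The machine's `r` against Peikert's `r₀ = q√(2n)/(γ₀ M d)`, `γ₀ = 2n/α` -/

/-- `⌊√(2n)⌋ ≤ √(2n) < ⌊√(2n)⌋ + 1`. [folklore] -/
theorem sqrt_two_mul_window (n : ℕ) :
    (Nat.sqrt (2 * n) : ℝ) ≤ Real.sqrt (2 * n) ∧ Real.sqrt (2 * n) ≤ (Nat.sqrt (2 * n) : ℝ) + 1 := by
  constructor
  · rw [Real.le_sqrt (Nat.cast_nonneg _) (by positivity)]
    exact_mod_cast Nat.sqrt_le' (2 * n)
  · rw [Real.sqrt_le_left (by positivity)]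
    have := Nat.lt_succ_sqrt' (2 * n)
    exact_mod_cast this.le

/-- **`A = q a (⌊√(2n)⌋+1)/(2n M d)`** as a real. [folklore] -/
theorem A_eq (hn : 1 ≤ dim ι) (haden : 0 < aden ι) (hd : (dden ι : ℤ) ≤ dnum ι) (hanum : 0 ≤ anum ι) :
    (numA ι : ℝ) / denA ι = (qv ι : ℝ) * ((anum ι : ℝ) / aden ι) * ((Nat.sqrt (2 * dim ι) : ℝ) + 1) /
      (2 * dim ι * (scale (dim ι) : ℝ) * (ι.1.2 : ℝ)) := by
  have hden : (0 : ℝ) < dden ι := by exact_mod_cast ι.1.2.den_pos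
  have hnum : (0 : ℝ) < dnum ι := by
    have : (0 : ℤ) < dnum ι := lt_of_lt_of_le (by exact_mod_cast ι.1.2.den_pos) hd
    exact_mod_cast this
  have habs : ((anum ι).natAbs : ℝ) = anum ι := by rw [Nat.cast_natAbs, Int.cast_abs, abs_of_nonneg (by exact_mod_cast hanum)]
  have hdabs : ((dnum ι).natAbs : ℝ) = dnum ι := by rw [Nat.cast_natAbs, Int.cast_abs, abs_of_pos hnum]
  obtain ⟨Mr, hMr⟩ : ∃ Mr : ℝ, ((scale (dim ι) : ℕ) : ℝ) = Mr := ⟨_, rfl⟩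
  have hMr0 : 0 < Mr := by rw [← hMr]; unfold scale; positivity
  unfold numA denA
  push_cast
  rw [habs, hdabs, hMr, d_eq_num_div_den]
  have haden' : (0 : ℝ) < aden ι := by exact_mod_cast haden
  have hn' : (0 : ℝ) < dim ι := by exact_mod_cast hn
  field_simp

/-- **The machine's radius is admissible for `no_case_scaled_unit` at `γ₀ = 2n/α`**:
`q√(2n)/(γ₀ M d) ≤ r ≤ 2 q√(2n)/(γ₀ M d)` (`n ≥ 2`, `q ≥ 1`, `a > 0`, `d ≥ 1`). [cite: Peikert2009, Thm. 3.1 proof] -/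
theorem rRat_window {q : ℕ → ℕ} {α : ℕ → ℝ} (hn : 2 ≤ dim ι) (hqv : (qv ι : ℝ) = q (dim ι)) (hq1 : 1 ≤ q (dim ι))
    (hanum : 0 < anum ι) (haden : 0 < aden ι) (hαa : α (dim ι) = (anum ι : ℝ) / aden ι) (hd : (dden ι : ℤ) ≤ dnum ι) :
    q (dim ι) * Real.sqrt (2 * dim ι) / (2 * dim ι / α (dim ι) * ((scale (dim ι) : ℝ) * (ι.1.2 : ℝ))) ≤ rRat ι ∧
    (rRat ι : ℝ) ≤ 2 * (q (dim ι) * Real.sqrt (2 * dim ι) / (2 * dim ι / α (dim ι) * ((scale (dim ι) : ℝ) * (ι.1.2 : ℝ)))) := by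
  have hn1 : 1 ≤ dim ι := by omega
  have hdenA := denA_pos ι hn1 haden hd
  have hqv1 : 1 ≤ qv ι := by
    have : (1 : ℝ) ≤ qv ι := by rw [hqv]; exact_mod_cast hq1
    exact_mod_cast this
  have hnumA := numA_pos ι hqv1 hanum.ne'
  have hA := A_eq ι hn1 haden hd hanum.le
  obtain ⟨hs1, hs2⟩ := sqrt_two_mul_window (dim ι)
  obtain ⟨Mr, hMr⟩ : ∃ Mr : ℝ, ((scale (dim ι) : ℕ) : ℝ) = Mr := ⟨_, rfl⟩
  have hMr0 : 0 < Mr := by rw [← hMr]; unfold scale; positivity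
  have hdpos := d_pos ι hd
  have hapos : 0 < α (dim ι) := by rw [hαa]; positivity
  have hnR : (2 : ℝ) ≤ dim ι := by exact_mod_cast hn
  have hqR : (1 : ℝ) ≤ q (dim ι) := by exact_mod_cast hq1
  -- `r₀ = A √(2n)/(s+1)`
  set s := (Nat.sqrt (2 * dim ι) : ℝ) with hsdef
  have hs2' : (2 : ℝ) ≤ s := by
    have : 2 ≤ Nat.sqrt (2 * dim ι) := by rw [Nat.le_sqrt']; omega
    rw [hsdef]; exact_mod_cast this
  have hr0 : q (dim ι) * Real.sqrt (2 * dim ι) / (2 * dim ι / α (dim ι) * (Mr * (ι.1.2 : ℝ))) =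
      (numA ι : ℝ) / denA ι * (Real.sqrt (2 * dim ι) / (s + 1)) := by
    rw [hA, hMr, ← hqv, hαa]
    field_simp
  rw [hMr, hr0]
  have hApos : 0 < (numA ι : ℝ) / denA ι := by positivity
  constructor
  · -- `A √(2n)/(s+1) ≤ A ≤ r`
    refine le_trans ?_ (A_le_rRat ι hdenA)
    have hfrac : Real.sqrt (2 * dim ι) / (s + 1) ≤ 1 := by rw [div_le_one (by positivity)]; exact hs2
    calc (numA ι : ℝ) / denA ι * (Real.sqrt (2 * dim ι) / (s + 1)) ≤ (numA ι : ℝ) / denA ι * 1 :=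
          mul_le_mul_of_nonneg_left hfrac hApos.le
      _ = _ := mul_one _
  · -- `r ≤ 4A/3 ≤ 2 A √(2n)/(s+1)` as `s + 1 ≤ 3s/2 ≤ 3√(2n)/2`
    refine (rRat_le_four_thirds ι hdenA hnumA).trans ?_
    have hfrac : 2 / 3 ≤ Real.sqrt (2 * dim ι) / (s + 1) := by
      rw [div_le_div_iff₀ (by norm_num) (by positivity)]; linarith
    nlinarith

/-! ### The NO bound for one block -/

/-- `x - w ∈ L(J)` for the residual of ANY perturbation vector. [cite: Babai1986, §3] -/
theorem residual_sub_mem (hI : ι.1.1.IsNonsingular) (w : Fin (dim ι) → ℤ) :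
    intVecToEuclidean (dim ι) (Babai.intResidual (J ι).basis w) - intVecToEuclidean (dim ι) w ∈ (J ι).lattice := by
  have hM : scale (dim ι) ≠ 0 := by unfold scale; positivity
  have hli : LinearIndependent ℝ (Babai.rowsR (J ι).basis) := by
    rw [← vec_eq_rowsR]; exact LatticeInstance.linearIndependent_vec (LatticeInstance.isNonsingular_scale hM hI)
  rw [Babai.intVecToEuclidean_intResidual _ hli]
  have h := Babai.residual_sub_mem_span (dim ι) (Babai.rowsR (J ι).basis) (intVecToEuclidean (dim ι) w)
  rw [← vec_eq_rowsR] at h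
  exact h

/-- **On a NO instance one iteration misfires with probability at most `2^{n/2}e^{-2n} + n·8·2^{-m} + ε`.**
Here `ε` bounds the solver's failure probability on `f`-admissible `BDD` inputs of dimension `n`
(hypothesis `hS`, the dimension-`n` slice of `SolvesBDD`), and `γ ≥ γ₀ = 2n/α`.
[cite: Peikert2009, Thm. 3.1 proof (NO case)] -/
theorem prob_block_notok_le_of_no {q : ℕ → ℕ} {α f ζ γ : ℕ → ℝ} (hno : ι.1 ∈ GapSVPZeta.no ζ γ)
    (hn : 3 ≤ dim ι) (hα : 0 < α (dim ι)) (hα1 : α (dim ι) < 1) (hf : 0 ≤ f (dim ι)) (hq1 : 1 ≤ q (dim ι))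
    (hqv : (qv ι : ℝ) = q (dim ι)) (hanum : 0 < anum ι) (haden : 0 < aden ι) (hαa : α (dim ι) = (anum ι : ℝ) / aden ι)
    (hγ : 2 * dim ι / α (dim ι) ≤ γ (dim ι))
    (hq : ζ (dim ι) * f (dim ι) * Real.sqrt (Real.log (dim ι)) / Real.sqrt (dim ι) ≤ q (dim ι))
    {ε : ℝ} (hε0 : 0 ≤ ε) (hε1 : ε ≤ 1)
    (hS : ∀ p' : GapCVPInstance, p'.1.I.n = dim ι → BDDAdmissible q α f p' →
      ENNReal.ofReal (1 - ε) ≤ (R.randRun O coinsR fuelR (GapCVPInstance.encode p')).toOuterMeasure (bddSuccess p')) :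
    ((uniformOfFintype (List.Vector Bool (blockLen ι coinsR))).toOuterMeasure
        {blk | okBlk coinsR fuelR R O ι blk.toList = false}).toReal ≤
      (2 : ℝ) ^ ((dim ι : ℝ) / 2) * Real.exp (-(2 * dim ι)) + dim ι * (8 * ((2 : ℝ) ^ prec (dim ι))⁻¹) + ε := by
  classical
  obtain ⟨⟨hI, -, hGS, hd1, hdζ⟩, hfar⟩ := hno
  have hd : (dden ι : ℤ) ≤ dnum ι := by
    have h := hd1
    rw [d_eq_num_div_den ι, le_div_iff₀ (by exact_mod_cast ι.1.2.den_pos), one_mul] at h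
    exact_mod_cast h
  have hn2 : 2 ≤ dim ι := by omega
  have hn1 : 1 ≤ dim ι := by omega
  set D := scaledD ι with hDdef
  set σ := sigma0 ι with hσdef
  have hDpos : 0 < D := by
    rw [hDdef]; unfold scaledD
    have h1 := d_pos ι hd
    have h2 : (0 : ℝ) < scale (dim ι) := by
      have : 0 < scale (dim ι) := by unfold scale; positivity
      exact_mod_cast this
    exact mul_pos h2 h1
  -- the one-block probability in product form, as a sum over the perturbation
  rw [prob_block_okBlk_eq coinsR fuelR R O ι hI false, jointLaw, bind_map_prod_comm, toOuterMeasure_bind_apply]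
  set big : Set (Fin (dim ι) → ℤ) := {w | D * Real.sqrt (dim ι) / 2 < ‖intVecToEuclidean (dim ι) w‖} with hbig
  set UT := uniformOfFintype (List.Vector Bool (tailLen ι coinsR)) with hUT
  -- KEY: for a short perturbation the solver's answer decodes to `x - w` except with probability `ε`
  have hkey : ∀ w, w ∉ big → (UT.map fun t => (t, w)).toOuterMeasure (okEvent coinsR fuelR R O ι false) ≤ ENNReal.ofReal ε := by
    intro w hw
    have hw' : ‖intVecToEuclidean (dim ι) w‖ ≤ D * Real.sqrt (dim ι) / 2 := not_lt.1 hw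
    -- the queried instance and its coins
    set p' := cvpOf ι w with hp'
    set u := GapCVPInstance.encode p' with hu
    set ℓ := coinsR.eval u.length with hℓ
    have hℓ' : ℓ ≤ tailLen ι coinsR := TM2Iter.eval_mono coinsR (length_encode_cvpOf_le_uBound ι hI w)
    -- admissibility and forced answer (`no_case_scaled_unit` at `γ₀ = 2n/α`)
    have hM0 : scale (dim ι) ≠ 0 := by unfold scale; positivity
    obtain ⟨Mr, hMr⟩ : ∃ Mr : ℝ, ((scale (dim ι) : ℕ) : ℝ) = Mr := ⟨_, rfl⟩
    have hMr1 : 1 ≤ Mr := by rw [← hMr]; exact_mod_cast Nat.one_le_two_pow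
    have hDM : D = Mr * (ι.1.2 : ℝ) := by rw [hDdef, scaledD, hMr]
    have hnpos : (0 : ℝ) < dim ι := by exact_mod_cast hn1
    have hγ0pos : 0 < 2 * (dim ι : ℝ) / α (dim ι) := div_pos (by linarith) hα
    obtain ⟨hr1, hr2⟩ := rRat_window ι (q := q) (α := α) hn2 hqv hq1 hanum haden hαa hd
    have hnc := no_case_scaled_unit (q := q) (α := α) (f := f) (ζ := ζ) (γ := fun k => 2 * k / α k) (J ι)
      (LatticeInstance.isNonsingular_scale hM0 hI) (M := Mr) (D := D) hMr1
      (by rw [hDM]; nlinarith [hd1])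
      (fun i => by rw [← hMr, LatticeInstance.norm_gramSchmidt_scale hM0]; exact le_mul_of_one_le_right (Nat.cast_nonneg _) (hGS i))
      (by
        show 2 * ((J ι).n : ℝ) / α (J ι).n * D < minNorm (J ι).lattice
        rw [LatticeInstance.minNorm_scale_lattice hM0, hMr, hDM]
        have h1 : 2 * (dim ι : ℝ) / α (dim ι) * (ι.1.2 : ℝ) < minNorm ι.1.1.lattice :=
          lt_of_le_of_lt (mul_le_mul_of_nonneg_right hγ (le_trans zero_le_one hd1)) hfar
        have := mul_lt_mul_of_pos_left h1 (lt_of_lt_of_le one_pos hMr1)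
        calc 2 * ((J ι).n : ℝ) / α (J ι).n * (Mr * (ι.1.2 : ℝ)) = Mr * (2 * (dim ι : ℝ) / α (dim ι) * (ι.1.2 : ℝ)) := by
              show 2 * (dim ι : ℝ) / α (dim ι) * (Mr * (ι.1.2 : ℝ)) = _; ring
          _ < Mr * minNorm ι.1.1.lattice := this)
      (by
        show D ≤ Mr * ζ (J ι).n / (2 * ((J ι).n : ℝ) / α (J ι).n)
        show D ≤ Mr * ζ (dim ι) / (2 * (dim ι : ℝ) / α (dim ι))
        rw [hDM, mul_div_assoc]
        refine mul_le_mul_of_nonneg_left (hdζ.trans ?_) (le_trans zero_le_one hMr1)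
        have hζ0 : 0 ≤ ζ (dim ι) := by
          have : 0 ≤ ζ ι.1.1.n / γ ι.1.1.n := le_trans zero_le_one (hd1.trans hdζ)
          have hγpos : 0 < γ (dim ι) := lt_of_lt_of_le hγ0pos hγ
          have := mul_nonneg this hγpos.le
          rwa [div_mul_cancel₀ _ hγpos.ne'] at this
        exact div_le_div_of_nonneg_left hζ0 hγ0pos hγ)
      hn hα hα1 hf hq1 (le_of_eq rfl) hq (Babai.intResidual (J ι).basis w) w (residual_sub_mem ι hI w)
      (by rwa [hDdef] at hw' ⊢) (rRat ι)
      (by rw [hDM, ← hMr]; exact hr1) (by rw [hDM, ← hMr]; exact hr2)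
    obtain ⟨hadm, huniq⟩ := hnc
    -- the solver's guarantee on `p'`, over its own uniform coins of length `ℓ`
    have hSp := hS p' rfl hadm
    -- rewrite our event as the preimage under `takeV ℓ` of the failure event over coins of length `ℓ`
    set G : Set (List.Vector Bool ℓ) := {c | decodeIntVec (dim ι) ((R.run O (fuelR.eval u.length) (boolPair u c.toList)).getD []) =
      Babai.intResidual (J ι).basis w - w} with hG
    have hev : (fun t : List.Vector Bool (tailLen ι coinsR) => (t, w)) ⁻¹' okEvent coinsR fuelR R O ι false = takeV ℓ hℓ' ⁻¹' Gᶜ := by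
      ext t
      simp only [Set.mem_preimage, okEvent, Set.mem_setOf_eq, okW, Set.mem_compl_iff, hG, takeV,
        OracleAlg.randAnswer_boolPair, decide_eq_false_iff_not, List.Vector.toList_mk]
      rfl
    rw [toOuterMeasure_map_apply, hev, ← toOuterMeasure_map_apply, uniform_map_takeV]
    -- `Pr[Gᶜ] = 1 - Pr[G] ≤ 1 - (1 - ε) = ε`
    have hGge : ENNReal.ofReal (1 - ε) ≤ (uniformOfFintype (List.Vector Bool ℓ)).toOuterMeasure G := by
      refine hSp.trans ?_
      rw [OracleAlg.randRun, toOuterMeasure_map_apply]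
      refine PMF.toOuterMeasure_mono _ fun c hc => ?_
      have hc' := hc.1
      simp only [Set.mem_preimage, bddSuccess, Set.mem_setOf_eq] at hc'
      exact huniq _ hc'
    have hsum := toOuterMeasure_compl_add (uniformOfFintype (List.Vector Bool ℓ)) G
    have hGc : (uniformOfFintype (List.Vector Bool ℓ)).toOuterMeasure Gᶜ = 1 - (uniformOfFintype (List.Vector Bool ℓ)).toOuterMeasure G :=
      ENNReal.eq_sub_of_add_eq (ne_top_of_le_ne_top ENNReal.one_ne_top (hsum ▸ le_self_add)) (by rw [add_comm]; exact hsum)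
    rw [hGc]
    calc 1 - (uniformOfFintype (List.Vector Bool ℓ)).toOuterMeasure G ≤ 1 - ENNReal.ofReal (1 - ε) := tsub_le_tsub_left hGge _
      _ = ENNReal.ofReal ε := by
          rw [← ENNReal.ofReal_one, ← ENNReal.ofReal_sub _ (by linarith)]
          congr 1; ring
  -- termwise bound and summation
  have hle1 : ∀ {X : Type} (p : PMF X) (s : Set X), p.toOuterMeasure s ≤ 1 := fun p s =>
    le_of_le_of_eq le_self_add (toOuterMeasure_compl_add p s)
  have hterm : ∀ w, nu ι w * (UT.map fun t => (t, w)).toOuterMeasure (okEvent coinsR fuelR R O ι false) ≤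
      nu ι w * big.indicator 1 w + nu ι w * ENNReal.ofReal ε := fun w => by
    by_cases hw : w ∈ big
    · rw [Set.indicator_of_mem hw, Pi.one_apply, mul_one]
      exact le_add_right (mul_le_of_le_one_right bot_le (hle1 _ _))
    · rw [Set.indicator_of_notMem hw, mul_zero, zero_add]
      exact mul_le_mul' le_rfl (hkey w hw)
  have hle : (∑' w, nu ι w * (UT.map fun t => (t, w)).toOuterMeasure (okEvent coinsR fuelR R O ι false)) ≤
      (nu ι).toOuterMeasure big + ENNReal.ofReal ε := by
    refine (ENNReal.tsum_le_tsum hterm).trans ?_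
    rw [ENNReal.tsum_add, ENNReal.tsum_mul_right, (nu ι).tsum_coe, one_mul, toOuterMeasure_apply]
    refine add_le_add (le_of_eq (tsum_congr fun w => ?_)) le_rfl
    by_cases hw : w ∈ big
    · rw [Set.indicator_of_mem hw, Set.indicator_of_mem hw, Pi.one_apply, mul_one]
    · rw [Set.indicator_of_notMem hw, Set.indicator_of_notMem hw, mul_zero]
  -- pass to reals
  have hbig_ne : (nu ι).toOuterMeasure big ≠ ∞ := ne_top_of_le_ne_top ENNReal.one_ne_top (hle1 _ _)
  have hR : (∑' w, nu ι w * (UT.map fun t => (t, w)).toOuterMeasure (okEvent coinsR fuelR R O ι false)).toReal ≤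
      ((nu ι).toOuterMeasure big).toReal + ε := by
    have h := ENNReal.toReal_mono (ENNReal.add_ne_top.2 ⟨hbig_ne, ENNReal.ofReal_ne_top⟩) hle
    rwa [ENNReal.toReal_add hbig_ne ENNReal.ofReal_ne_top, ENNReal.toReal_ofReal hε0] at h
  -- the tail of the perturbation: rounded Gaussian tail + statistical error
  have hbigR : ((nu ι).toOuterMeasure big).toReal ≤ (2 : ℝ) ^ ((dim ι : ℝ) / 2) * Real.exp (-(2 * dim ι)) + dim ι * (8 * ((2 : ℝ) ^ prec (dim ι))⁻¹) := by
    have htv := abs_sub_le_iff.1 ((abs_toReal_toOuterMeasure_sub_le_tvDist (nu ι) (roundedGaussian (dim ι) σ) big).trans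
      (tvDist_nu_roundedGaussian_le ι hd))
    have htail : ((roundedGaussian (dim ι) σ).toOuterMeasure big).toReal ≤ (2 : ℝ) ^ ((dim ι : ℝ) / 2) * Real.exp (-(2 * dim ι)) := by
      refine roundedGaussian_norm_tail_le hn2 (half_le_sigma0 ι) ?_
      have h8 : σ ≤ D / 8 := sigma0_le_scaledD_div_eight ι hd
      have hsq : 0 ≤ Real.sqrt (dim ι) := Real.sqrt_nonneg _
      have := mul_le_mul_of_nonneg_right h8 hsq
      linarith
    linarith [htv.1]
  linarith

end Spec

end Peikert2009

end Literature.Computability.Cryptography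

end
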